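import Literature.MathematicalPhysics.QuantumFieldTheory.Balaban1983to89.BlockAveragingExpMeanLog
import Literature.MathematicalPhysics.QuantumFieldTheory.Balaban1983to89.LogChartClosedSubgroup
import Literature.MathematicalPhysics.QuantumFieldTheory.Balaban1983to89.T4Apex
import HarnessLib

/-!
# `UVNonSUNRec` — stub S1′ `stub_emlAverage` discharged: Bałaban's exp-mean-log small-loop average on an
# ARBITRARY embedded compact group `r(G) ⊂ U(N)` (Spin, Sp, exceptional, centre quotients included)

Support module for the residual leg `UVOtherGroups ↦ UVNonSUNRec` of `route-QuantumFields-BalabanLadder`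
(`stmt-QuantumFields-19356`; honest framing: a residual leg of a CONDITIONAL chain, not a gap / Clay claim).
It proves, with no hypothesis on `G` beyond compactness and the existence of the faithful unitary lattice
representation `r`, the statement `HasEmlAverage r hN` of the registered skeleton
`Cruxes/UVNonSUNRec/Lines/birth.lean` (decl `Summit.QuantumFields.YangMills.Cruxes.UVNonSUNRec.Birth.HasEmlAverage`,
restated here character-for-character so that the skeleton's `stub_emlAverage` closes by
`exact Summit.QuantumFields.YangMills.Theorems.UVNonSUNRec.stub_emlAverage_holds`, definitional unfolding only):

* over the `GaugeGroup` structure induced by `r` (`dist1 g = ‖r g − 1‖`, `UnitaryModel` §4) there is a small-loop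
  average `ℰ : LoopAverage G` — radius `δ = ρ_{r(G)}` = the radius of the tree's log chart of the CLOSED SUBGROUP
  `r(G) ⊂ M_N(ℂ)` (`LogChartClosedSubgroup.closedSubgroupLogChart`, Hall Thm 3.42 / Cor 3.44), value
  `E W = r⁻¹(exp[|I|⁻¹ Σ_i log r(W_i)])` on the guard `∀ i, ‖r(W_i) − 1‖ < δ` and `1` off it — which is Borel
  measurable at every arity (`LoopAverage.MeasurableE`) and whose image under `r` IS the printed operation
  `ExpMeanLog.eml (r ∘ W)` of [Balaban1987RG1] (0.4) on the guard.

THE ONE MATHEMATICAL POINT (`eml_mem_range`): for a `δ`-small family in `r(G)`, `log r(W_i) ∈ 𝔤 = lieOf r(G)`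
(the chart), the MEAN stays in the real subspace `𝔤`, and `exp 𝔤 ⊆ r(G)`; hence `eml (r ∘ W) ∈ r(G)` and `E W` is
well defined by faithfulness.  The axioms (0.5) inverses, (0.6) conjugations, (0.7) permutations are the tree's
`ExpMeanLog.eml_inv_mul` / `eml_conj` / `eml_comp_equiv` pulled back through the injective homomorphism `r`;
measurability: `r ∘ E` is the piecewise of a map continuous on the OPEN guard (`ExpMeanLog.continuousAt_eml`) and a
constant, and `r` is a closed (hence measurable) embedding of the compact group `G`.

No `sorry`, no new axioms, no instances / notation declared (instances are introduced only locally with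
`haveI`/`letI` inside statements and proofs, exactly as in the skeleton's `HasEmlAverage`).

References: [cite: Balaban1987RG1, (0.4)–(0.7) p.253] (the operation and its axioms; p. 253 «G … a Lie subgroup of a
group of complex unitary matrices»); [cite: Hall2015, Thm. 3.42, Cor. 3.44] (closed-subgroup log chart);
[cite: BrockerTomDieck1985, III (4.1)] (faithful unitary representation of a compact Lie group).
-/

set_option autoImplicit false

noncomputable section

open MeasureTheory Filter Topology NormedSpace
open scoped Matrix.Norms.L2Operator
open Literature.MathematicalPhysics.QuantumFieldTheory
open Literature.MathematicalPhysics.QuantumFieldTheory.Balaban1983to89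
open Literature.MathematicalPhysics.QuantumFieldTheory.Balaban1983to89.LogChartClosedSubgroup
  (closedSubgroupLogChart closedSubgroupLogChart_ρ_le)

namespace Summit.QuantumFields.YangMills.Theorems.UVNonSUNRec

variable {G : Type} [Group G] [TopologicalSpace G]

/-- **`HasEmlAverage r` — VERBATIM the skeleton's S1′ statement** (`Cruxes/UVNonSUNRec/Lines/birth.lean`): over the
`GaugeGroup` structure induced by `r` (`dist1 g = ‖r g − 1‖`, `reTr = Re tr r(·)/N`) and the Borel σ-algebra, a
measurable small-loop average `ℰ` whose image under `r` is Bałaban's printed `exp[|I|⁻¹ Σ_i log r(W_i)]` on the guard.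
[cite: Balaban1987RG1, (0.4)–(0.7) p.253] -/
def HasEmlAverage {G : Type} [Group G] [TopologicalSpace G] (r : LatticeRep G) (hN : 0 < r.N) : Prop :=
  haveI : Nonempty (Fin r.N) := ⟨⟨0, hN⟩⟩
  letI : GaugeGroup G := GaugeGroup.ofUnitaryRep G r.ρ r.mem_unitary
  letI : MeasurableSpace G := borel G
  ∃ ℰ : LoopAverage G, ℰ.MeasurableE ∧ ∀ (m : ℕ) (W : Fin (m + 1) → G), (∀ i, dist1 (W i) < ℰ.δ) →
    r.ρ (ℰ.E W) = ExpMeanLog.eml (fun i => r.ρ (W i))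

/-! ## 1. The log chart of the closed subgroup `r(G) ⊂ M_N(ℂ)` and its radius -/

section Chart

/-- `r(G)` has left inverses inside `r(G)`: `r(g⁻¹) r(g) = 1`. [folklore] -/
theorem inv_mem_range (r : LatticeRep G) : ∀ a ∈ Set.range r.ρ, ∃ b ∈ Set.range r.ρ, b * a = 1 := by
  rintro _ ⟨g, rfl⟩
  exact ⟨r.ρ g⁻¹, ⟨g⁻¹, rfl⟩, by rw [← map_mul, inv_mul_cancel, map_one]⟩

variable [CompactSpace G] (r : LatticeRep G)

/-- The log chart of the closed subgroup `r(G)` of `M_N(ℂ)` (compact `G`): carrier `r(G)`, Lie algebra Hall's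
`𝔤 = {X | ∀ t, exp(tX) ∈ r(G)}`, radius `min(r_{r(G)}/2, 1/4)`. [cite: Hall2015, Thm. 3.42, Cor. 3.44] -/
def chart : LogChart (Matrix (Fin r.N) (Fin r.N) ℂ) :=
  closedSubgroupLogChart (Set.range r.ρ) r.isClosed_range r.one_mem_range r.mul_mem_range (inv_mem_range r)

/-- The radius `δ_r` of the eml-average: the chart radius of `r(G)`. [cite: Hall2015, Cor. 3.44] -/
def emlRadius : ℝ := (chart r).ρ

/-- `0 < δ_r`. [cite: Hall2015, Cor. 3.44] -/
theorem emlRadius_pos : 0 < emlRadius r := (chart r).ρ_pos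

/-- `δ_r ≤ 1/4`. [cite: Hall2015, Cor. 3.44] -/
theorem emlRadius_le : emlRadius r ≤ 1 / 4 :=
  closedSubgroupLogChart_ρ_le r.isClosed_range r.one_mem_range r.mul_mem_range (inv_mem_range r)

/-- `δ_r ≤ 1/3` (the radius of the `U(N)` model `expMeanLogU`). [folklore] -/
theorem emlRadius_le_third : emlRadius r ≤ 1 / 3 := (emlRadius_le r).trans (by norm_num)

/-- `δ_r < 1` (so that `eml` is continuous on the guard). [folklore] -/
theorem emlRadius_lt_one : emlRadius r < 1 := lt_of_le_of_lt (emlRadius_le r) (by norm_num)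

/-- **THE ONE MATHEMATICAL POINT.** Bałaban's `exp[|I|⁻¹ Σ_i log W_i]` of a `δ_r`-small family IN `r(G)` lies IN
`r(G)`: each `log W_i ∈ 𝔤` (the chart), the mean stays in the real subspace `𝔤`, `exp 𝔤 ⊆ r(G)`.
[cite: Hall2015, Thm. 3.42] [cite: Balaban1987RG1, (0.4) p.253] -/
theorem eml_mem_range {ι : Type} [Fintype ι] {W : ι → Matrix (Fin r.N) (Fin r.N) ℂ}
    (hW : ∀ i, W i ∈ Set.range r.ρ) (hsmall : ∀ i, ‖W i - 1‖ < emlRadius r) :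
    ExpMeanLog.eml W ∈ Set.range r.ρ := by
  rw [ExpMeanLog.eml_eq_exp_sum]
  have hmem : ∑ i, ((Fintype.card ι : ℝ))⁻¹ • MatrixLog.mlog (W i) ∈ (chart r).lie :=
    Submodule.sum_mem _ fun i _ => Submodule.smul_mem _ _ ((chart r).mlog_mem (hW i) (hsmall i).le)
  exact (chart r).exp_mem hmem

end Chart

/-! ## 2. The averaged group element `E W = r⁻¹(eml (r ∘ W))` and the axioms (0.5)–(0.7) -/

section Avg

variable [CompactSpace G] (r : LatticeRep G)

/-- The eml-average of a finite family in `G`: `r⁻¹(exp[|I|⁻¹ Σ_i log r(W_i)])` on the guard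
`∀ i, ‖r(W_i) − 1‖ < δ_r` (well defined by `eml_mem_range` and faithfulness), `1` off it.
[cite: Balaban1987RG1, (0.4) p.253] -/
def emlAvg {m : ℕ} (W : Fin (m + 1) → G) : G := by
  classical
  exact if h : ∀ i, ‖r.ρ (W i) - 1‖ < emlRadius r then
    (Set.mem_range.1 (eml_mem_range r (W := fun i => r.ρ (W i)) (fun i => ⟨W i, rfl⟩) h)).choose
  else 1

/-- On the guard, `r(E W)` IS the printed operation. [cite: Balaban1987RG1, (0.4) p.253] -/
theorem rho_emlAvg_of_small {m : ℕ} {W : Fin (m + 1) → G} (h : ∀ i, ‖r.ρ (W i) - 1‖ < emlRadius r) :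
    r.ρ (emlAvg r W) = ExpMeanLog.eml (fun i => r.ρ (W i)) := by
  classical
  rw [emlAvg, dif_pos h]
  exact (Set.mem_range.1 (eml_mem_range r (W := fun i => r.ρ (W i)) (fun i => ⟨W i, rfl⟩) h)).choose_spec

/-- Off the guard, `E W = 1`. [folklore] -/
theorem emlAvg_of_not_small {m : ℕ} {W : Fin (m + 1) → G} (h : ¬ ∀ i, ‖r.ρ (W i) - 1‖ < emlRadius r) :
    emlAvg r W = 1 := by
  classical
  rw [emlAvg, dif_neg h]

/-- **(0.7) permutations** (all families). [cite: Balaban1987RG1, (0.7) p.253] -/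
theorem emlAvg_perm {m : ℕ} (W : Fin (m + 1) → G) (σ : Equiv.Perm (Fin (m + 1))) :
    emlAvg r (W ∘ σ) = emlAvg r W := by
  by_cases h : ∀ i, ‖r.ρ (W i) - 1‖ < emlRadius r
  · have h' : ∀ i, ‖r.ρ ((W ∘ σ) i) - 1‖ < emlRadius r := fun i => h (σ i)
    apply r.injective
    rw [rho_emlAvg_of_small r h', rho_emlAvg_of_small r h]
    exact ExpMeanLog.eml_comp_equiv (fun i => r.ρ (W i)) σ
  · have h' : ¬ ∀ i, ‖r.ρ ((W ∘ σ) i) - 1‖ < emlRadius r := fun h' => h fun i => by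
      have := h' (σ.symm i)
      rwa [Function.comp_apply, Equiv.apply_symm_apply] at this
    rw [emlAvg_of_not_small r h', emlAvg_of_not_small r h]

/-- **(0.5) inverses** on the guard. [cite: Balaban1987RG1, (0.5) p.253] -/
theorem emlAvg_inv {m : ℕ} {W : Fin (m + 1) → G} (h : ∀ i, ‖r.ρ (W i) - 1‖ < emlRadius r) :
    emlAvg r (fun i => (W i)⁻¹) = (emlAvg r W)⁻¹ := by
  have h' : ∀ i, ‖r.ρ (W i)⁻¹ - 1‖ < emlRadius r := fun i => by
    have := UnitaryModel.opDist1_map_inv r.ρ r.mem_unitary (W i)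
    simp only [UnitaryModel.opDist1] at this
    rw [this]
    exact h i
  apply eq_inv_of_mul_eq_one_left
  apply r.injective
  rw [map_mul, map_one, rho_emlAvg_of_small r h', rho_emlAvg_of_small r h]
  exact ExpMeanLog.eml_inv_mul (fun i => by rw [← map_mul, mul_inv_cancel, map_one])
    fun i => (h i).le.trans (emlRadius_le_third r)

/-- **(0.6) conjugations** on the guard. [cite: Balaban1987RG1, (0.6) p.253] -/
theorem emlAvg_conj {m : ℕ} {W : Fin (m + 1) → G} (h : ∀ i, ‖r.ρ (W i) - 1‖ < emlRadius r) (u : G) :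
    emlAvg r (fun i => u * W i * u⁻¹) = u * emlAvg r W * u⁻¹ := by
  have hvw : r.ρ u * r.ρ u⁻¹ = 1 := by rw [← map_mul, mul_inv_cancel, map_one]
  have hwv : r.ρ u⁻¹ * r.ρ u = 1 := by rw [← map_mul, inv_mul_cancel, map_one]
  have h' : ∀ i, ‖r.ρ (u * W i * u⁻¹) - 1‖ < emlRadius r := fun i => by
    rw [map_mul, map_mul, ExpMeanLog.norm_conj_sub_one_eq (r.mem_unitary u) (r.mem_unitary u⁻¹) hvw]
    exact h i
  apply r.injective
  rw [rho_emlAvg_of_small r h', map_mul, map_mul, rho_emlAvg_of_small r h]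
  simp_rw [map_mul]
  exact ExpMeanLog.eml_conj hvw hwv (fun i => r.ρ (W i))

end Avg

/-! ## 3. Measurability: `r ∘ E` is the piecewise of a map continuous on the open guard and a constant -/

section Meas

variable [CompactSpace G] (r : LatticeRep G)

/-- The guard `{W | ∀ i, ‖r(W_i) − 1‖ < δ_r}` is open in `(Fin (m+1) → G)`. [folklore] -/
theorem isOpen_guard (m : ℕ) : IsOpen {W : Fin (m + 1) → G | ∀ i, ‖r.ρ (W i) - 1‖ < emlRadius r} := by
  rw [Set.setOf_forall]
  exact isOpen_iInter_of_finite fun i =>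
    isOpen_lt (((r.continuous.comp (continuous_apply i)).sub continuous_const).norm) continuous_const

/-- `W ↦ eml (r ∘ W)` is continuous on the guard (`eml` is analytic on `1`-small families). [folklore] -/
theorem continuousOn_eml_rho (m : ℕ) :
    ContinuousOn (fun W : Fin (m + 1) → G => ExpMeanLog.eml (fun i => r.ρ (W i)))
      {W | ∀ i, ‖r.ρ (W i) - 1‖ < emlRadius r} := by
  intro W hW
  have hco : Continuous fun W : Fin (m + 1) → G => fun i => r.ρ (W i) :=
    continuous_pi fun i => r.continuous.comp (continuous_apply i)
  have hat : ContinuousAt (ExpMeanLog.eml : (Fin (m + 1) → Matrix (Fin r.N) (Fin r.N) ℂ) → _)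
      (fun i => r.ρ (W i)) :=
    ExpMeanLog.continuousAt_eml fun i => lt_of_lt_of_le (hW i) (emlRadius_lt_one r).le
  exact (hat.comp hco.continuousAt).continuousWithinAt

/-- **MEASURABILITY of `E`** at every arity (Borel σ-algebra on `G`, product σ-algebra on families): `r` is a closed,
hence measurable, embedding of the compact group `G` into `M_N(ℂ)` (Borel σ-algebra on `M_N(ℂ)`, introduced locally
in the proof), and `r ∘ E` is the piecewise of `eml ∘ (r ∘ ·)` (continuous on the open guard) and the constant `1`.
[folklore] -/
theorem measurable_emlAvg [MeasurableSpace G] [BorelSpace G] (m : ℕ) :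
    Measurable fun W : Fin (m + 1) → G => emlAvg r W := by
  classical
  letI : MeasurableSpace (Matrix (Fin r.N) (Fin r.N) ℂ) := borel _
  haveI : BorelSpace (Matrix (Fin r.N) (Fin r.N) ℂ) := ⟨rfl⟩
  haveI : SecondCountableTopology G :=
    (r.continuous.isClosedEmbedding r.injective).isEmbedding.secondCountableTopology
  have hEmb : MeasurableEmbedding r.ρ := (r.continuous.isClosedEmbedding r.injective).measurableEmbedding
  rw [← hEmb.measurable_comp_iff]
  set s : Set (Fin (m + 1) → G) := {W | ∀ i, ‖r.ρ (W i) - 1‖ < emlRadius r} with hs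
  have hpw : Measurable (s.piecewise (fun W : Fin (m + 1) → G => ExpMeanLog.eml (fun i => r.ρ (W i)))
      (fun _ => (1 : Matrix (Fin r.N) (Fin r.N) ℂ))) :=
    ContinuousOn.measurable_piecewise (continuousOn_eml_rho r m) continuousOn_const
      (isOpen_guard r m).measurableSet
  have heq : (r.ρ ∘ fun W : Fin (m + 1) → G => emlAvg r W) =
      s.piecewise (fun W : Fin (m + 1) → G => ExpMeanLog.eml (fun i => r.ρ (W i)))
        (fun _ => (1 : Matrix (Fin r.N) (Fin r.N) ℂ)) := by
    funext W
    by_cases hW : W ∈ s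
    · rw [Set.piecewise_eq_of_mem _ _ _ hW, Function.comp_apply]
      exact rho_emlAvg_of_small r hW
    · rw [Set.piecewise_eq_of_notMem _ _ _ hW, Function.comp_apply, emlAvg_of_not_small r hW, map_one]
  rw [heq]
  exact hpw

end Meas

/-! ## 4. The inhabitant of `LoopAverage G` over the structure induced by `r`, and the discharge -/

section Discharge

/-- **`HasEmlAverage r hN` holds for EVERY faithful unitary lattice representation `r` of EVERY compact group `G`**
(no `SU(N)` hypothesis: Spin, Sp, exceptional groups and centre quotients included): the eml-average of §2 packaged
as a `LoopAverage G` over `GaugeGroup.ofUnitaryRep G r.ρ r.mem_unitary` (radius `δ_r`, axioms (0.5)–(0.7) from §2),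
measurable by §3, and equal under `r` to the printed operation on the guard by construction.
[cite: Balaban1987RG1, (0.4)–(0.7) p.253] [cite: Hall2015, Thm. 3.42] -/
theorem hasEmlAverage {G : Type} [Group G] [TopologicalSpace G] [CompactSpace G] (r : LatticeRep G)
    (hN : 0 < r.N) : HasEmlAverage r hN := by
  haveI : Nonempty (Fin r.N) := ⟨⟨0, hN⟩⟩
  letI : GaugeGroup G := GaugeGroup.ofUnitaryRep G r.ρ r.mem_unitary
  letI : MeasurableSpace G := borel G
  haveI : BorelSpace G := ⟨rfl⟩
  refine ⟨{ δ := emlRadius r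
            δ_pos := emlRadius_pos r
            E := fun W => emlAvg r W
            inv := fun W hW => emlAvg_inv r hW
            conj := fun W hW u => emlAvg_conj r hW u
            perm := fun W _ σ => emlAvg_perm r W σ }, fun m => measurable_emlAvg r m, fun m W hW => ?_⟩
  exact rho_emlAvg_of_small r hW

/-- **STUB S1′ DISCHARGED, VERBATIM**: the skeleton's `stub_emlAverage` (its `[IsTopologicalGroup G]` binder is not
used). [cite: Balaban1987RG1, (0.4)–(0.7) p.253] [cite: Hall2015, Thm. 3.42] -/
theorem stub_emlAverage_holds :
    ∀ (G : Type) [Group G] [TopologicalSpace G] [IsTopologicalGroup G] [CompactSpace G]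
      (r : LatticeRep G) (hN : 0 < r.N), HasEmlAverage r hN :=
  fun _ _ _ _ _ r hN => hasEmlAverage r hN

end Discharge


end Summit.QuantumFields.YangMills.Theorems.UVNonSUNRec
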